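import Summits.Ventures.HSemireg.WedgeModelCoord
import HarnessLib

/-!
# Venture HSemireg — S4-PUSH corner 2 (twisted sheaves ∕ complexes at `n = 6`), seat `gs-eng-2` (gen 25):
# SLOT FORMS in Mathlib's exterior algebra — `h_i = E_{S i}`, `D = Σ_i h_i`, `Ω = Σ_{i<j} h_i ∧ h_j` (`= D^{[2]}`):
# commutation, `D³ = 0` in characteristic `3`, `D ∧ Ω = 0`, `Ω ≠ 0`, coordinates of triple products, and the
# unique decomposition of non-slot pairs — the infrastructure of the KERNEL LEG `DualSieveDegreeSixKernel.lean`
# (cell record: this seat's `general-structure/XCHECK-K0-gs2.md` §4e (ii) KERNEL FACT of LEMMA SIX-EIGHT;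
# s4-search-2's S4-PR-51 (T6) THEOREM β uses the same fact)

HONEST FRAMING. Count-neutral infrastructure: finite-dimensional exterior algebra over a field ONLY, in the
tree's sign-free wedge model `Summit.Ventures.HSemireg.Wedge` (th-7 ∕ p3: `HT K I = ⋀(I → K)` = Mathlib's
`ExteriorAlgebra`, monomial basis `B K I : Basis (Finset I) K (HT K I)` = Mathlib's `Basis.ExteriorAlgebra`,
structure constants `u K s t` — UNITS iff `s ∩ t = ∅`, whose values are never used here either). NO definition is
introduced (all sums are written out); no variety, no sheaf, no `σ`, no census count; nothing here says HC ∕ HC_CM ∕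
HC_AV holds; no Literature fact is declared or used. NOT formalised (as in the sister leaves `DualSieveDegreeFour`,
`DividedSquareUniqueness`, `DividedPowerBinomialTransform`, `DividedSquareLemma`, `DualSieveArithmetic`): the
lattice-to-coordinates translation of XCHECK-K0 §4 ∕ §4e (the `D`-adapted symplectic basis of `Λ′`, reduction mod `3`).

SETTING. `I` a finite linear order (the generators), `S : Fin m → Finset I` a family of pairwise disjoint
`2`-element SLOTS (`S i = {a_i, b_i}`; further generators outside the slots — e.g. the radical slot of §4e — are
allowed), `h_i := E_{S i} = a_i ∧ b_i` the SLOT FORMS, `D := Σ_i h_i`, `Ω := Σ_{i<j} h_i ∧ h_j`.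
* §0 monomial helpers: `E_s ∧ E_s = 0` (`s ≠ ∅`), even monomials are central (`B_mul_B_of_even`, from th-7's parity
  law `B_mul_B_comm`), coordinates of `E_s`, `E_s ∧ E_t`, `E_p ∧ (E_s ∧ E_t)` (a product of structure units at the
  union, else `0`), and the written-out coordinate of `(Σ_x c_x E_{τ x}) ∧ Ω` (`coord_sum_mul_sum`); two finite-sum
  bookkeeping lemmas (`sum_sum_eq_single`, `sum_eq_three`).
* §1 slot forms: `h_i ∧ h_i = 0`, `h_i` central (`hslot_comm`), `S` injective, «a slot inside a union of slots is one
  of them» (`mem_of_slot_subset_biUnion`, `eq_or_eq_of_slot_subset`); FROBENIUS `(Σ_{i∈A} h_i)³ = 0` when `3 = 0` in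
  `K` (`sum_slots_pow_three`: `(x+y)³ = x³ + y³ + 3xy·r` for commuting `x, y`, Mathlib's
  `Commute.exists_add_pow_prime_eq`); `D ∧ D = 2Ω` (`D_mul_D` — so `Ω` is the divided square `D^{[2]}` of the cell's
  record, cf. `DividedPowerBinomialTransform.pow_eq_factorial_mul_esymm`); hence `D ∧ Ω = 0` in characteristic `3`
  (`D_mul_Omega`: `2·(D ∧ Ω) = D³ = 0`, `2 ≠ 0`); and `Ω ≠ 0` as soon as two slots exist (`Omega_ne_zero`: its
  coordinate at `S i₀ ⊔ S j₀` is a unit).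
* §2 UNIQUE DECOMPOSITION (`generic_unique`): for a `2`-set `t₀` which is not a slot and slots `i₀ < j₀` disjoint
  from it, `t ⊔ S i ⊔ S j = t₀ ⊔ S i₀ ⊔ S j₀` (`i < j`, `t` disjoint from `S i ∪ S j`) forces `(t,i,j) = (t₀,i₀,j₀)`
  — the pencil's «the `6`-monomial `g_k g_l h_i h_j` remembers `(k,l)` as its two half-occupied slots»; with `m ≥ 4`
  slots every `t` with `#t ≤ 2` leaves two slots disjoint from it (`exists_disjoint_slots`, a counting argument);
  and `(x ∧ y) ∧ (x ∧ y) = 0` for vectors `x, y` (`ι_mul_ι_mul_self`: decomposable `2`-vectors square to zero).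
References: graded commutativity and `(x ∧ y)² = 0` [cite: BourbakiAlgebre1a3, Ch. III §7 nos. 1, 5].
-/
open Module Finset

namespace Summit.Ventures.HSemireg.DualSieveSlotForms

open Summit.Ventures.HSemireg.Wedge

variable (K : Type*) [Field K] {I : Type*} [LinearOrder I] [Fintype I]

/-! ## §0 Monomial helpers (Mathlib's exterior algebra `HT K I = ⋀(I → K)` with its monomial basis `B`) -/

/-- a non-empty monomial squares to zero. -/
lemma B_mul_self {s : Finset I} (hs : s.Nonempty) : B K I s * B K I s = 0 := by
  rw [B_mul_B, u_eq_zero K (fun h => hs.ne_empty ((Finset.disjoint_self_iff_empty _).mp h)), zero_smul]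

/-- an even monomial commutes with every monomial. -/
lemma B_mul_B_of_even {s : Finset I} (hs : Even s.card) (t : Finset I) :
    B K I s * B K I t = B K I t * B K I s := by
  rw [B_mul_B_comm K s t, Even.neg_one_pow (hs.mul_left _), one_smul]

/-- the coordinate of a monomial. -/
lemma coord_B (s t : Finset I) : (B K I).coord t (B K I s) = if s = t then 1 else 0 := by
  classical
  rw [Basis.coord_apply, Basis.repr_self, Finsupp.single_apply]

/-- the coordinate of a product of two monomials: a structure constant on the union, else `0`. -/
lemma coord_B_mul_B (s t r : Finset I) :
    (B K I).coord r (B K I s * B K I t) = if s ∪ t = r then u K s t else 0 := by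
  classical
  rw [B_mul_B, map_smul, smul_eq_mul, coord_B]
  split_ifs <;> simp

/-- the coordinate of a product of three monomials `E_p ∧ (E_s ∧ E_t)`. -/
lemma coord_B_mul_B_mul_B (p s t r : Finset I) :
    (B K I).coord r (B K I p * (B K I s * B K I t)) =
      if p ∪ (s ∪ t) = r then u K s t * u K p (s ∪ t) else 0 := by
  classical
  rw [B_mul_B, mul_smul_comm, B_mul_B, smul_smul, map_smul, smul_eq_mul, coord_B]
  split_ifs <;> simp

/-- the coordinate at `r` of `(Σ_x c_x • E_{τ x}) ∧ (Σ_{i<j} E_{S i} ∧ E_{S j})`, written out. -/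
lemma coord_sum_mul_sum {γ : Type*} (X : Finset γ) (c : γ → K) (τ : γ → Finset I)
    {m : ℕ} (S : Fin m → Finset I) (r : Finset I) :
    (B K I).coord r ((∑ x ∈ X, c x • B K I (τ x)) *
        ∑ i, ∑ j, if i < j then B K I (S i) * B K I (S j) else 0) =
      ∑ x ∈ X, ∑ i, ∑ j, if i < j ∧ τ x ∪ (S i ∪ S j) = r
        then c x * (u K (S i) (S j) * u K (τ x) (S i ∪ S j)) else 0 := by
  classical
  rw [Finset.sum_mul, map_sum]
  refine Finset.sum_congr rfl fun x _ => ?_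
  rw [Finset.mul_sum, map_sum]
  refine Finset.sum_congr rfl fun i _ => ?_
  rw [Finset.mul_sum, map_sum]
  refine Finset.sum_congr rfl fun j _ => ?_
  rw [mul_ite, mul_zero, smul_mul_assoc, apply_ite ((B K I).coord r), map_zero, map_smul, smul_eq_mul,
    coord_B_mul_B_mul_B, ite_and]
  split_ifs <;> simp

/-- a double sum with a single surviving term. -/
lemma sum_sum_eq_single {M : Type*} [AddCommMonoid M] {m : ℕ} (G : Fin m → Fin m → M) (i₀ j₀ : Fin m)
    (hG : ∀ i j, ¬ (i = i₀ ∧ j = j₀) → G i j = 0) : ∑ i, ∑ j, G i j = G i₀ j₀ := by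
  rw [Finset.sum_eq_single_of_mem i₀ (Finset.mem_univ _) fun i _ hi =>
    Finset.sum_eq_zero fun j _ => hG i j fun h => hi h.1]
  exact Finset.sum_eq_single_of_mem j₀ (Finset.mem_univ _) fun j _ hj => hG i₀ j fun h => hj h.2

/-- a sum with three surviving terms. -/
lemma sum_eq_three {M : Type*} [AddCommMonoid M] {m : ℕ} (g : Fin m → M) {a b c : Fin m}
    (hab : a ≠ b) (hac : a ≠ c) (hbc : b ≠ c) (hg : ∀ k, k ≠ a → k ≠ b → k ≠ c → g k = 0) :
    ∑ k, g k = g a + g b + g c := by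
  classical
  have hsub : ({a, b, c} : Finset (Fin m)) ⊆ Finset.univ := Finset.subset_univ _
  rw [← Finset.sum_subset hsub fun k _ hk => hg k (fun h => hk (by simp [h])) (fun h => hk (by simp [h]))
    (fun h => hk (by simp [h])), Finset.sum_insert (by simp [hab, hac]), Finset.sum_insert (by simp [hbc]),
    Finset.sum_singleton, add_assoc]

/-! ## §1 Slot forms: pairwise disjoint `2`-element slots `S i`, `h_i := E_{S i}`, `D := Σ h_i`,
`Ω := Σ_{i<j} h_i ∧ h_j` -/

variable {m : ℕ} (S : Fin m → Finset I)

omit [LinearOrder I] [Fintype I] in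
/-- a slot is non-empty. -/
lemma slot_nonempty (h2 : ∀ i, (S i).card = 2) (i : Fin m) : (S i).Nonempty := by
  rw [← Finset.card_pos, h2]; exact Nat.zero_lt_two

/-- a slot form squares to zero. -/
lemma hslot_mul_self (h2 : ∀ i, (S i).card = 2) (i : Fin m) : B K I (S i) * B K I (S i) = 0 :=
  B_mul_self K (slot_nonempty S h2 i)

/-- a slot form commutes with every monomial. -/
lemma hslot_comm (h2 : ∀ i, (S i).card = 2) (i : Fin m) (t : Finset I) :
    B K I (S i) * B K I t = B K I t * B K I (S i) :=
  B_mul_B_of_even K (by rw [h2]; exact even_two) t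

omit [LinearOrder I] [Fintype I] in
/-- the slot map is injective. -/
lemma slot_injective (h2 : ∀ i, (S i).card = 2) (hd : Pairwise fun i j => Disjoint (S i) (S j)) :
    Function.Injective S := by
  intro i j hij
  by_contra hne
  have h : Disjoint (S i) (S j) := hd hne
  rw [hij, Finset.disjoint_self_iff_empty] at h
  exact (slot_nonempty S h2 j).ne_empty h

omit [Fintype I] in
/-- a slot contained in a union of slots is one of them. -/
lemma mem_of_slot_subset_biUnion (h2 : ∀ i, (S i).card = 2) (hd : Pairwise fun i j => Disjoint (S i) (S j))
    {x : Fin m} {A : Finset (Fin m)} (h : S x ⊆ A.biUnion S) : x ∈ A := by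
  classical
  obtain ⟨y, hy⟩ := slot_nonempty S h2 x
  obtain ⟨a, ha, hya⟩ := Finset.mem_biUnion.mp (h hy)
  by_cases hxa : x = a
  · rwa [hxa]
  · exact (Finset.disjoint_left.mp (hd hxa) hy hya).elim

omit [Fintype I] in
/-- a slot contained in `t ∪ (S i ∪ S j)` and different from the `2`-set `t` is `S i` or `S j`. -/
lemma eq_or_eq_of_slot_subset (h2 : ∀ i, (S i).card = 2) (hd : Pairwise fun i j => Disjoint (S i) (S j))
    {t : Finset I} (ht : t.card = 2) {k i j : Fin m} (hk : S k ≠ t) (h : S k ⊆ t ∪ (S i ∪ S j)) :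
    k = i ∨ k = j := by
  by_cases hki : k = i
  · exact Or.inl hki
  by_cases hkj : k = j
  · exact Or.inr hkj
  exfalso
  have hsub : S k ⊆ t := by
    intro y hy
    rcases Finset.mem_union.mp (h hy) with h' | h'
    · exact h'
    · rcases Finset.mem_union.mp h' with h'' | h''
      · exact (Finset.disjoint_left.mp (hd hki) hy h'').elim
      · exact (Finset.disjoint_left.mp (hd hkj) hy h'').elim
  exact hk (Finset.eq_of_subset_of_card_le hsub (by rw [ht, h2]))

omit [LinearOrder I] [Fintype I] in
/-- `(3 : ⋀ V) = 0` over a field with `3 = 0`. -/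
lemma three_eq_zero (h3 : (3 : K) = 0) : (3 : HT K I) = 0 := by
  rw [← map_ofNat (algebraMap K (HT K I)) 3, h3, map_zero]

/-- over a field with `3 = 0`, `2` is invertible. -/
lemma two_ne_zero_of_three (h3 : (3 : K) = 0) : (2 : K) ≠ 0 := by
  intro h2
  have : (3 : K) - 2 = 1 := by norm_num
  rw [h3, h2, sub_zero] at this
  exact zero_ne_one this

/-- FROBENIUS: in characteristic `3` the cube of a sum of slot forms vanishes,
`(Σ_{i∈A} h_i)³ = Σ h_i³ = 0` (the `h_i` commute pairwise and square to zero). -/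
lemma sum_slots_pow_three (h2 : ∀ i, (S i).card = 2) (h3 : (3 : K) = 0) (A : Finset (Fin m)) :
    (∑ i ∈ A, B K I (S i)) ^ 3 = 0 := by
  classical
  induction A using Finset.induction_on with
  | empty => simp
  | insert a A ha ih =>
    rw [Finset.sum_insert ha]
    have hc : Commute (B K I (S a)) (∑ i ∈ A, B K I (S i)) :=
      Commute.sum_right _ _ _ fun j _ => hslot_comm K S h2 a (S j)
    obtain ⟨r, hr⟩ := hc.exists_add_pow_prime_eq Nat.prime_three
    rw [hr, ih, Nat.cast_ofNat, three_eq_zero K h3, zero_mul, zero_mul, zero_mul, add_zero, add_zero,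
      pow_three, hslot_mul_self K S h2, mul_zero]

/-- `D ∧ D = 2 Ω`: the square of `D = Σ h_i` is twice `Ω = Σ_{i<j} h_i ∧ h_j` (so `Ω` is the divided square
`D^{[2]}` of the cell's record, cf. `DividedPowerBinomialTransform`). -/
lemma D_mul_D (h2 : ∀ i, (S i).card = 2) :
    (∑ i, B K I (S i)) * (∑ i, B K I (S i)) =
      (2 : K) • ∑ i, ∑ j, if i < j then B K I (S i) * B K I (S j) else 0 := by
  rw [Finset.sum_mul_sum, two_smul]
  have hsplit : ∀ i j, B K I (S i) * B K I (S j) =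
      (if i < j then B K I (S i) * B K I (S j) else 0) + (if j < i then B K I (S i) * B K I (S j) else 0) := by
    intro i j
    rcases lt_trichotomy i j with hij | rfl | hji
    · rw [if_pos hij, if_neg (lt_asymm hij), add_zero]
    · rw [if_neg (lt_irrefl _), add_zero, hslot_mul_self K S h2]
    · rw [if_neg (lt_asymm hji), if_pos hji, zero_add]
  rw [Finset.sum_congr rfl fun i _ => Finset.sum_congr rfl fun j _ => hsplit i j]
  simp only [Finset.sum_add_distrib]
  congr 1
  rw [Finset.sum_comm]
  refine Finset.sum_congr rfl fun i _ => Finset.sum_congr rfl fun j _ => ?_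
  split_ifs
  · exact hslot_comm K S h2 j (S i)
  · rfl

/-- `D ∧ Ω = 0` in characteristic `3` (`2 · D ∧ Ω = D³ = 0` and `2 ≠ 0`): `D` lies in the kernel. -/
lemma D_mul_Omega (h2 : ∀ i, (S i).card = 2) (h3 : (3 : K) = 0) :
    (∑ i, B K I (S i)) * (∑ i, ∑ j, if i < j then B K I (S i) * B K I (S j) else 0) = 0 := by
  have h := sum_slots_pow_three K S h2 h3 Finset.univ
  rw [pow_three, D_mul_D K S h2, mul_smul_comm, smul_eq_zero] at h
  exact h.resolve_left (two_ne_zero_of_three K h3)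

/-- `Ω ≠ 0` as soon as there are two slots (its coordinate at `S i₀ ⊔ S j₀` is a unit). -/
lemma Omega_ne_zero (h2 : ∀ i, (S i).card = 2) (hd : Pairwise fun i j => Disjoint (S i) (S j))
    {i₀ j₀ : Fin m} (hlt : i₀ < j₀) :
    (∑ i, ∑ j, if i < j then B K I (S i) * B K I (S j) else 0) ≠ 0 := by
  classical
  intro h0
  have h := congr_arg ((B K I).coord (S i₀ ∪ S j₀)) h0
  rw [map_zero, map_sum] at h
  simp_rw [map_sum, apply_ite ((B K I).coord (S i₀ ∪ S j₀)), map_zero, coord_B_mul_B] at h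
  rw [sum_sum_eq_single _ i₀ j₀, if_pos hlt, if_pos rfl] at h
  · exact (u_ne_zero_iff K).mpr (hd hlt.ne) h
  · intro i j hne
    split_ifs with hij heq
    · exfalso
      have hmem : ∀ {x}, S x ⊆ S i ∪ S j → x = i₀ ∨ x = j₀ := by
        intro x hx
        have hx' : S x ⊆ ({i₀, j₀} : Finset (Fin m)).biUnion S := by
          simpa [Finset.biUnion_insert, Finset.singleton_biUnion, heq] using hx
        simpa using mem_of_slot_subset_biUnion S h2 hd hx'
      rcases hmem Finset.subset_union_left with rfl | rfl <;>
        rcases hmem Finset.subset_union_right with rfl | rfl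
      · exact lt_irrefl _ hij
      · exact hne ⟨rfl, rfl⟩
      · exact lt_asymm hlt hij
      · exact lt_irrefl _ hij
    · rfl
    · rfl

/-! ## §2 Unique decomposition of non-slot pairs; two free slots; decomposable squares -/

omit [Fintype I] in
/-- UNIQUE DECOMPOSITION: for a `2`-set `t₀` which is not a slot and two slots `i₀ < j₀` disjoint from it,
`t ⊔ (S i ⊔ S j) = t₀ ⊔ (S i₀ ⊔ S j₀)` with `i < j` and `t` disjoint from `S i ∪ S j` forces `(t, i, j) = (t₀, i₀, j₀)`. -/
lemma generic_unique (h2 : ∀ i, (S i).card = 2) (hd : Pairwise fun i j => Disjoint (S i) (S j))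
    {t₀ : Finset I} (ht₀ : t₀.card = 2) (hgen : ∀ k, S k ≠ t₀) {i₀ j₀ : Fin m} (hlt₀ : i₀ < j₀)
    (hi₀ : Disjoint t₀ (S i₀)) (hj₀ : Disjoint t₀ (S j₀))
    {t : Finset I} {i j : Fin m} (hlt : i < j) (hdisj : Disjoint t (S i ∪ S j))
    (heq : t ∪ (S i ∪ S j) = t₀ ∪ (S i₀ ∪ S j₀)) : t = t₀ ∧ i = i₀ ∧ j = j₀ := by
  have hSi : S i ⊆ t₀ ∪ (S i₀ ∪ S j₀) := by
    rw [← heq]; exact Finset.subset_union_left.trans Finset.subset_union_right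
  have hSj : S j ⊆ t₀ ∪ (S i₀ ∪ S j₀) := by
    rw [← heq]; exact Finset.subset_union_right.trans Finset.subset_union_right
  have hi := eq_or_eq_of_slot_subset S h2 hd ht₀ (hgen i) hSi
  have hj := eq_or_eq_of_slot_subset S h2 hd ht₀ (hgen j) hSj
  have hij : i = i₀ ∧ j = j₀ := by
    rcases hi with rfl | rfl <;> rcases hj with rfl | rfl
    · exact absurd hlt (lt_irrefl _)
    · exact ⟨rfl, rfl⟩
    · exact absurd (hlt₀.trans hlt) (lt_irrefl _)
    · exact absurd hlt (lt_irrefl _)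
  obtain ⟨rfl, rfl⟩ := hij
  refine ⟨?_, rfl, rfl⟩
  rw [← Finset.union_sdiff_cancel_right hdisj, heq,
    Finset.union_sdiff_cancel_right (Finset.disjoint_union_right.mpr ⟨hi₀, hj₀⟩)]

omit [LinearOrder I] [Fintype I] in
/-- with at least four slots, every set `t` with `#t ≤ 2` (it meets at most two slots) leaves two slots
`i₀ < j₀` disjoint from it. -/
lemma exists_disjoint_slots [DecidableEq I] (hd : Pairwise fun i j => Disjoint (S i) (S j)) (hm : 4 ≤ m)
    {t : Finset I} (ht : t.card ≤ 2) :
    ∃ i₀ j₀ : Fin m, i₀ < j₀ ∧ Disjoint t (S i₀) ∧ Disjoint t (S j₀) := by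
  have hA : (Finset.univ.filter fun k : Fin m => ¬ Disjoint t (S k)).card ≤ t.card :=
    calc (Finset.univ.filter fun k : Fin m => ¬ Disjoint t (S k)).card
        = ∑ k ∈ Finset.univ.filter (fun k : Fin m => ¬ Disjoint t (S k)), 1 := by simp
      _ ≤ ∑ k ∈ Finset.univ.filter (fun k : Fin m => ¬ Disjoint t (S k)), (t ∩ S k).card :=
          Finset.sum_le_sum fun k hk => Finset.card_pos.mpr
            (Finset.not_disjoint_iff_nonempty_inter.mp (Finset.mem_filter.mp hk).2)
      _ = ((Finset.univ.filter fun k : Fin m => ¬ Disjoint t (S k)).biUnion fun k => t ∩ S k).card :=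
          (Finset.card_biUnion fun a _ b _ hab => Finset.disjoint_of_subset_left Finset.inter_subset_right
            (Finset.disjoint_of_subset_right Finset.inter_subset_right (hd hab))).symm
      _ ≤ t.card := Finset.card_le_card (Finset.biUnion_subset.mpr fun k _ => Finset.inter_subset_left)
  have hsplit := Finset.card_filter_add_card_filter_not (s := (Finset.univ : Finset (Fin m)))
    (fun k : Fin m => Disjoint t (S k))
  rw [Finset.card_univ, Fintype.card_fin] at hsplit
  obtain ⟨a, ha, b, hb, hab⟩ := Finset.one_lt_card.mp
    (show 1 < (Finset.univ.filter fun k : Fin m => Disjoint t (S k)).card by omega)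
  rcases lt_or_gt_of_ne hab with h | h
  · exact ⟨a, b, h, (Finset.mem_filter.mp ha).2, (Finset.mem_filter.mp hb).2⟩
  · exact ⟨b, a, h, (Finset.mem_filter.mp hb).2, (Finset.mem_filter.mp ha).2⟩

omit [LinearOrder I] [Fintype I] in
/-- a decomposable `2`-vector squares to zero: `(x ∧ y) ∧ (x ∧ y) = 0` (so the corollary applies to `β = x ∧ y`). -/
lemma ι_mul_ι_mul_self (x y : I → K) :
    (ExteriorAlgebra.ι K x * ExteriorAlgebra.ι K y) * (ExteriorAlgebra.ι K x * ExteriorAlgebra.ι K y) = 0 := by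
  have hyx : ExteriorAlgebra.ι K y * ExteriorAlgebra.ι K x = -(ExteriorAlgebra.ι K x * ExteriorAlgebra.ι K y) :=
    eq_neg_of_add_eq_zero_left (ExteriorAlgebra.ι_add_mul_swap y x)
  rw [mul_assoc, ← mul_assoc (ExteriorAlgebra.ι K y), hyx, neg_mul, mul_assoc, ExteriorAlgebra.ι_sq_zero,
    mul_zero, neg_zero, mul_zero]

end Summit.Ventures.HSemireg.DualSieveSlotForms
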